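import Summits.BirchSwinnertonDyer.Rank1Residual.Supersingular.MazurTateTwistedNonvanishingLayers
import Literature.NumberTheory.EllipticCurves.KatoTwistedFinitenessTowerRankProofs
import Literature.NumberTheory.EllipticCurves.KatoTwistedFinitenessTrivialCharacterProofs
import Literature.NumberTheory.EllipticCurves.PAdicLFunctionNeZeroHoldsProofs
import HarnessLib

/-!
# A Mazur–Tate certificate forbids vanishing twists, part 2: the complex `L`-values
# `L(E, χ, 1) ≠ 0`, and (under Kato's Cor. 14.3) no Mordell–Weil growth along `(ℚ(ζ_M))^H`
# (cell `b2b-bsdres`, supersingular family, prover B = unit `b2b-bsdres-additive-p3`, gen 6; part 2)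

HONEST FRAMING (run/shared/lean/b2b/bsd-rank1-residual/, verbatim in every file): the goal of the
cell is to DELETE the COMBINATION-SHAPED residual classes of the Birch–Swinnerton-Dyer formula for
ALL analytic-rank `≤ 1` elliptic curves over `ℚ` — "full BSD formula for every rank `≤ 1` curve in
class `C`" assembled STRICTLY from published theorems — so that the rank-`≤ 1` remainder becomes
exactly the CONSTRUCTION-SHAPED classes, which are TYPED (missing-input `Prop`s), NOT attempted.
This is not "finishing BSD". THEOREMS ONLY; the one NAMED FACT used (§3, hypothesis `hK`) is the
tree's existing `kato_finite_chiPart_of_twistedLValue_ne_zero` (Kato, Astérisque 295, Cor. 14.3 (2);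
NOT proved in the tree) and enters only the theorems that display it. Nothing about any particular
curve is asserted; nothing is booked; X8 / X7 / X6 stay CONSTRUCTION-SHAPED.

## What this file proves

Part 1 (`MazurTateTwistedNonvanishing(Layers).lean`) reads out of ONE Mazur–Tate certificate the
non-vanishing of Birch's twisted symbol sums `∑_a χ(a)[a/p^{n+1}]⁺_f` for `ℂ_p`-valued characters.
Here the statement is moved to the complex side and to Mordell–Weil groups:

* `exists_ringHomComp_eq` — a Dirichlet character with values in a field `L` descends along any
  field embedding `K → L` when `K` has enough roots of unity (`exists_monoidHom_map_eq`); with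
  `K = ℚ(ζ_e) ⊂ ℂ, ℂ_p` (`e` the exponent of `(ℤ/M)ˣ`) this transports "all `ℂ_p`-valued primitive
  even `p`-power-order `χ` mod `M` have non-zero Birch sum" to the `ℂ`-valued characters
  (`forall_complex_ratTwistedSymbolSum_ne_zero_of_padic`; the sums are `ℚ(ζ_e)`-rational).
* `twistedLValue_ne_zero_of_ratTwistedSymbolSum_ne_zero` — Birch's formula (PROVED in the tree,
  `ratTwistedSymbolSum_mul_plusPeriod_holds`, with `Ω⁺_f > 0`, `IsNewform0.plusPeriod_pos_holds`):
  `∑_a χ̄(a)[a/M]⁺_f ≠ 0` ⇒ every entire continuation of `∑ χ(n) aₙ n⁻ˢ` is `≠ 0` at `s = 1`.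
* `forall_odd_twistedLValue_ne_zero_of_lam_sharp_le` / `forall_even_…_of_lam_flat_le` (and the
  `a_p = 0` forms `…_of_lam_signed_neg_one/one_le`): for `p ≠ 2` good, `p ∣ a_p`, THE Sprung pair with
  `μ(L♯) = 0`, `λ(L♯) ≤ p − 2` (resp. `μ(L♭) = 0`, `λ(L♭) + p ≤ p(p−1)`): **`L(E, χ, 1) ≠ 0` for every
  primitive even `p`-power-order `χ` of conductor `p^{n+1}`, `n` odd (resp. `n ≥ 2` even)**.
* `exists_nsmul_mem_range_baseChange_of_kato` (**no Mordell–Weil growth, relative form; under `hK`**):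
  for `E/ℚ` with newform `f`, `M ≥ 1`, `H ⊂ Gal(ℚ(ζ_M)/ℚ)`: if `L(f, χ, 1) ≠ 0` (entire continuation of
  the mod-`M` series) for every NON-TRIVIAL Dirichlet character `χ` mod `M` trivial on `H`, then every
  point of `E(ℚ(ζ_M))` fixed by `H` has a positive multiple in the image of `E(ℚ)`; i.e.
  `E(ℚ(ζ_M)^H) ⊗ ℚ = E(ℚ) ⊗ ℚ`. (Isotypic exhaustion `exists_pos_smul_mem_iSup_chiPart_complex`;
  Kato for `χ ≠ 1`; Galois descent `mem_chiPart_one_iff` for `χ = 1`.) The absolute form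
  (`H`-fixed points torsion when also `L(f, 1) ≠ 0`) is the tree's
  `isOfFinAddOrder_point_of_kato_of_twistedLValue_ne_zero`; this is its rank-`≥ 1` companion.

READING (nothing booked): for the 21 X8 rank-one pairs with `λ♯ = 1` and `λ♭ ≤ 3` (kernel records,
two engines) no character of the cyclotomic `ℤ_3`-tower twists `L(E, s)` to vanish at `s = 1`;
granted Kato's Cor. 14.3 (2), `E(ℚ_n) ⊗ ℚ = E(ℚ) ⊗ ℚ` (rank `1`, Gross–Zagier–Kolyvagin) at every
layer `ℚ_n` — the input `e_n = 0 (n ≥ 1)` of Kurihara–Pollack 2007, Prop. 3.1 / Greenberg's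
Problem 0.7, now read off the certificate. The layer-by-layer assembly for `ℚ_n ⊂ ℚ(ζ_{p^{n+1}})`
(the characters trivial on the prime-to-`p` torsion are exactly the even `p`-power-order ones) is
left to a records/consumer file.

References: K. Kato, Astérisque 295 (2004), Cor. 14.3 (2), Thm. 14.4 (pp. 235–236); B. Mazur,
J. Tate, J. Teitelbaum, Invent. Math. 84 (1986) §I.8 (8.6); D. Rohrlich, Invent. Math. 75 (1984);
M. Kurihara, R. Pollack, LMS Lecture Note Ser. 320 (2007) §0.3, Prop. 3.1; J. Cremona, *Algorithms
for modular elliptic curves* (1997) §2.8. Memo: `HOME/b2b-bsdres-additive-p3/X8-ROUTE-B.md` §11.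
-/

set_option autoImplicit false

noncomputable section

open scoped Classical MatrixGroups ModularForm

open CongruenceSubgroup Polynomial WeierstrassCurve WeierstrassCurve.Affine
  Literature.NumberTheory.EllipticCurves
  Literature.NumberTheory.EllipticCurves.ModularForms
  Literature.NumberTheory.EllipticCurves.Sprung2017
  Literature.NumberTheory.EllipticCurves.Rank1Residual
  Summit.BirchSwinnertonDyer.Rank1Residual.X1.MuLambda

namespace Summit.BirchSwinnertonDyer.Rank1Residual.Supersingular

/-! ## §1. Descent of Dirichlet characters and transport of the Birch sums `ℂ_p ↝ ℂ` -/

section Transport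

/-- **A Dirichlet character descends along a field embedding** `ι : K → L` when `K` has enough
`exp((ℤ/M)ˣ)`-th roots of unity: `χ = ψ.ringHomComp ι` for some `ψ` mod `M` with values in `K`
(its unit-group character descends, `exists_monoidHom_map_eq`). [folklore] -/
theorem exists_ringHomComp_eq {M : ℕ} [NeZero M] {K L : Type*} [Field K] [Field L]
    [HasEnoughRootsOfUnity K (Monoid.exponent (ZMod M)ˣ)] (ι : K →+* L)
    (χ : DirichletCharacter L M) : ∃ ψ : DirichletCharacter K M, ψ.ringHomComp ι = χ := by
  obtain ⟨χ', hχ'⟩ := exists_monoidHom_map_eq (G := (ZMod M)ˣ) ι χ.toUnitHom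
  refine ⟨MulChar.ofUnitHom χ', MulChar.ext fun a ↦ ?_⟩
  rw [MulChar.ringHomComp_apply, MulChar.ofUnitHom_coe, hχ', MulChar.coe_toUnitHom]

/-- **`ℚ(ζ_e)` embeds into `ℂ_p`** (`ℂ_p` is algebraically closed of characteristic zero; Mathlib
`IsAlgClosed.lift`). [folklore] -/
theorem nonempty_ringHom_cyclotomicField_padicComplex (p : ℕ) [Fact p.Prime] (e : ℕ) :
    Nonempty (CyclotomicField e ℚ →+* ℂ_[p]) :=
  ⟨(IsAlgClosed.lift (R := ℚ) (M := ℂ_[p]) (S := CyclotomicField e ℚ)).toRingHom⟩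

variable {N : ℕ} (f : CuspForm (Gamma0 N) 2) {p : ℕ} [hp : Fact p.Prime]

set_option backward.isDefEq.respectTransparency false in
/-- **Transport `ℂ_p ↝ ℂ` of "every primitive even `p`-power-order Birch sum mod `M` is non-zero".**
If `∑_a χ(a)[a/M]⁺_f ≠ 0` for every such `χ` with values in `ℂ_p`, then also for every such `χ` with
values in `ℂ`: both descend to `K = ℚ(ζ_e)` (`e = exp (ℤ/M)ˣ`), which embeds into `ℂ` and into
`ℂ_p` (algebraically closed), and the sums are `K`-rational (`ratTwistedSymbolSum_ringHomComp`);
primitivity, parity and order are transported by `isPrimitive/even_ringHomComp_iff`,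
`orderOf_ringHomComp`. (The option identifies the two `ℚ`-algebra structures on `ℚ(ζ_e)`, as in
the tree's `exists_pos_smul_mem_iSup_chiPart_complex`.) [folklore] -/
theorem forall_complex_ratTwistedSymbolSum_ne_zero_of_padic {M : ℕ} [NeZero M]
    (h : ∀ χ : DirichletCharacter ℂ_[p] M, χ.IsPrimitive → χ.Even → (∃ j : ℕ, orderOf χ = p ^ j) →
      ratTwistedSymbolSum f χ ≠ 0)
    (χ : DirichletCharacter ℂ M) (hχ : χ.IsPrimitive) (hev : χ.Even)
    (hord : ∃ j : ℕ, orderOf χ = p ^ j) : ratTwistedSymbolSum f χ ≠ 0 := by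
  have he : Monoid.exponent (ZMod M)ˣ ≠ 0 := Monoid.exponent_ne_zero_of_finite
  haveI : NeZero (Monoid.exponent (ZMod M)ˣ) := ⟨he⟩
  haveI : NeZero ((Monoid.exponent (ZMod M)ˣ : ℕ) : ℚ) := ⟨Nat.cast_ne_zero.mpr he⟩
  haveI : HasEnoughRootsOfUnity (CyclotomicField (Monoid.exponent (ZMod M)ˣ) ℚ)
      (Monoid.exponent (ZMod M)ˣ) :=
    ⟨⟨IsCyclotomicExtension.zeta (Monoid.exponent (ZMod M)ˣ) ℚ
        (CyclotomicField (Monoid.exponent (ZMod M)ˣ) ℚ),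
      IsCyclotomicExtension.zeta_spec (Monoid.exponent (ZMod M)ˣ) ℚ
        (CyclotomicField (Monoid.exponent (ZMod M)ˣ) ℚ)⟩, inferInstance⟩
  obtain ⟨σ⟩ : Nonempty (CyclotomicField (Monoid.exponent (ZMod M)ˣ) ℚ →+* ℂ) := by
    rw [← Fintype.card_pos_iff, NumberField.Embeddings.card]
    exact Module.finrank_pos
  obtain ⟨τ⟩ := nonempty_ringHom_cyclotomicField_padicComplex p (Monoid.exponent (ZMod M)ˣ)
  obtain ⟨ψ, rfl⟩ := exists_ringHomComp_eq σ χ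
  have hψprim : ψ.IsPrimitive := (isPrimitive_ringHomComp_iff σ ψ).mp hχ
  have hψev : ψ.Even := (even_ringHomComp_iff σ ψ).mp hev
  have hψord : ∃ j : ℕ, orderOf ψ = p ^ j := by rwa [orderOf_ringHomComp] at hord
  have hτ := h (ψ.ringHomComp τ) ((isPrimitive_ringHomComp_iff τ ψ).mpr hψprim)
    ((even_ringHomComp_iff τ ψ).mpr hψev) (by rw [orderOf_ringHomComp]; exact hψord)
  rw [ratTwistedSymbolSum_ringHomComp, map_ne_zero_iff τ τ.injective] at hτ
  rwa [ratTwistedSymbolSum_ringHomComp, map_ne_zero_iff σ σ.injective]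

end Transport

/-! ## §2. From Birch sums to `L(f, χ, 1) ≠ 0` -/

section LValue

variable {W : WeierstrassCurve ℚ} [W.IsElliptic] [W.IsGloballyMinimal] {N : ℕ} [NeZero N]
  {f : CuspForm (Gamma0 N) 2}

omit [W.IsElliptic] [W.IsGloballyMinimal] in
/-- **Birch: a non-zero sum `∑_a χ̄(a)[a/M]⁺_f` makes `L(f, χ, 1) ≠ 0`.** For the newform `f` of
`E = W` and a primitive even Dirichlet character `χ` mod `M` (values in `ℂ`): if
`∑_a χ⁻¹(a)[a/M]⁺_f ≠ 0` then every entire continuation `L` of `∑ χ(n) aₙ n⁻ˢ` has `L(1) ≠ 0`, since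
`(∑ χ⁻¹(a)[a/M]⁺) Ω⁺_f = τ(χ⁻¹) L(1)` (`ratTwistedSymbolSum_mul_plusPeriod_holds`) and `Ω⁺_f > 0`
(`IsNewform0.plusPeriod_pos_holds`). [cite: MazurTateTeitelbaum1986Invent, §I.8 (8.6)] -/
theorem twistedLValue_ne_zero_of_ratTwistedSymbolSum_ne_zero (hf : IsNewformOf W f) {M : ℕ}
    [NeZero M] {χ : DirichletCharacter ℂ M} (hχ : χ.IsPrimitive) (hev : χ.Even)
    (hsum : ratTwistedSymbolSum f χ⁻¹ ≠ 0) {L : ℂ → ℂ} (hLd : Differentiable ℂ L)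
    (hL : ∀ s : ℂ, 2 < s.re → L s = twistedLSeries f χ s) : L 1 ≠ 0 := by
  have hQ : coeffField f = ⊥ := hf.coeffField_eq_bot
  have hprim' : DirichletCharacter.IsPrimitive χ⁻¹ := by
    rw [DirichletCharacter.isPrimitive_def, DirichletCharacter.conductor_inv]; exact hχ
  have hev' : DirichletCharacter.Even χ⁻¹ := by
    change χ⁻¹ (-1) = 1
    rw [MulChar.inv_apply_eq_inv', hev, inv_one]
  have hL' : ∀ s : ℂ, 2 < s.re → L s = twistedLSeries f (χ⁻¹)⁻¹ s := by
    rw [inv_inv]; exact hL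
  have hB := ratTwistedSymbolSum_mul_plusPeriod_holds (f := f) hf.1 hQ hprim' hev' hLd hL'
  intro h1
  rw [h1, mul_zero, mul_eq_zero] at hB
  rcases hB with h0 | h0
  · exact hsum h0
  · exact (IsNewform0.plusPeriod_pos_holds (f := f) hf.1 hQ).ne' (by exact_mod_cast h0)

variable {p : ℕ} [hp : Fact p.Prime]

omit [W.IsElliptic] [W.IsGloballyMinimal] in
/-- **`L(f, χ, 1) ≠ 0` for all primitive even `p`-power-order `χ` mod `M`, from the `ℂ_p`-side
statement** (transport + Birch; the family is closed under `χ ↦ χ⁻¹`). [cite: MazurTateTeitelbaum1986Invent, §I.8 (8.6)] -/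
theorem forall_twistedLValue_ne_zero_of_padic (hf : IsNewformOf W f) {M : ℕ} [NeZero M]
    (h : ∀ χ : DirichletCharacter ℂ_[p] M, χ.IsPrimitive → χ.Even → (∃ j : ℕ, orderOf χ = p ^ j) →
      ratTwistedSymbolSum f χ ≠ 0)
    (χ : DirichletCharacter ℂ M) (hχ : χ.IsPrimitive) (hev : χ.Even)
    (hord : ∃ j : ℕ, orderOf χ = p ^ j) {L : ℂ → ℂ} (hLd : Differentiable ℂ L)
    (hL : ∀ s : ℂ, 2 < s.re → L s = twistedLSeries f χ s) : L 1 ≠ 0 := by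
  have hprim' : DirichletCharacter.IsPrimitive χ⁻¹ := by
    rw [DirichletCharacter.isPrimitive_def, DirichletCharacter.conductor_inv]; exact hχ
  have hev' : DirichletCharacter.Even χ⁻¹ := by
    change χ⁻¹ (-1) = 1
    rw [MulChar.inv_apply_eq_inv', hev, inv_one]
  have hord' : ∃ j : ℕ, orderOf χ⁻¹ = p ^ j := by rwa [orderOf_inv]
  exact twistedLValue_ne_zero_of_ratTwistedSymbolSum_ne_zero hf hχ hev
    (forall_complex_ratTwistedSymbolSum_ne_zero_of_padic f h χ⁻¹ hprim' hev' hord') hLd hL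

/-- **`λ(L♯) ≤ p − 2` ⇒ `L(E, χ, 1) ≠ 0` for every primitive even `p`-power-order `χ` of conductor
`p^{n+1}`, `n` odd** (`p ≠ 2` good, `p ∣ a_p`, THE Sprung pair, `L♯ ≠ 0`, `μ(L♯) = 0`; `L` any entire
continuation of the twisted series). [cite: Sprung2017, §3 and Cor. 3.6] [cite: MazurTateTeitelbaum1986Invent, §I.8 (8.6)] -/
theorem forall_odd_twistedLValue_ne_zero_of_lam_sharp_le (hp2 : p ≠ 2) (hf : IsNewformOf W f)
    (hgood : W.HasGoodReductionAtPrime p) (hap : (p : ℤ) ∣ W.frobeniusTrace p)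
    {Lsharp Lflat : IwasawaAlgebra p} (hSP : IsSprungPair f p (W.frobeniusTrace p) Lsharp Lflat)
    (hL0 : Lsharp ≠ 0) (hμL : mu Lsharp = 0) (hsmall : lam Lsharp + 2 ≤ p) {n : ℕ} (hn : Odd n)
    (χ : DirichletCharacter ℂ (p ^ (n + cyclotomicExponent p))) (hχ : χ.IsPrimitive)
    (hev : χ.Even) (hord : ∃ j : ℕ, orderOf χ = p ^ j) {L : ℂ → ℂ} (hLd : Differentiable ℂ L)
    (hL : ∀ s : ℂ, 2 < s.re → L s = twistedLSeries f χ s) : L 1 ≠ 0 :=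
  haveI : NeZero (p ^ (n + cyclotomicExponent p)) := ⟨pow_ne_zero _ hp.out.ne_zero⟩
  forall_twistedLValue_ne_zero_of_padic hf
    (fun χ' hχ' hev' hord' ↦ forall_odd_ratTwistedSymbolSum_ne_zero_of_lam_sharp_le hp2 hf hgood hap
      hSP hL0 hμL hsmall hn χ' hχ' hev' hord') χ hχ hev hord hLd hL

/-- **`λ(L♭) + p ≤ p(p−1)` ⇒ `L(E, χ, 1) ≠ 0` for every primitive even `p`-power-order `χ` of
conductor `p^{n+1}`, `n ≥ 2` even.** [cite: Sprung2017, §3 and Cor. 3.6] [cite: MazurTateTeitelbaum1986Invent, §I.8 (8.6)] -/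
theorem forall_even_twistedLValue_ne_zero_of_lam_flat_le (hp2 : p ≠ 2) (hf : IsNewformOf W f)
    (hgood : W.HasGoodReductionAtPrime p) (hap : (p : ℤ) ∣ W.frobeniusTrace p)
    {Lsharp Lflat : IwasawaAlgebra p} (hSP : IsSprungPair f p (W.frobeniusTrace p) Lsharp Lflat)
    (hL0 : Lflat ≠ 0) (hμL : mu Lflat = 0) (hsmall : lam Lflat + p ≤ p * (p - 1)) {n : ℕ}
    (hn : Even n) (hn0 : 0 < n)
    (χ : DirichletCharacter ℂ (p ^ (n + cyclotomicExponent p))) (hχ : χ.IsPrimitive)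
    (hev : χ.Even) (hord : ∃ j : ℕ, orderOf χ = p ^ j) {L : ℂ → ℂ} (hLd : Differentiable ℂ L)
    (hL : ∀ s : ℂ, 2 < s.re → L s = twistedLSeries f χ s) : L 1 ≠ 0 :=
  haveI : NeZero (p ^ (n + cyclotomicExponent p)) := ⟨pow_ne_zero _ hp.out.ne_zero⟩
  forall_twistedLValue_ne_zero_of_padic hf
    (fun χ' hχ' hev' hord' ↦ forall_even_ratTwistedSymbolSum_ne_zero_of_lam_flat_le hp2 hf hgood hap
      hSP hL0 hμL hsmall hn hn0 χ' hχ' hev' hord') χ hχ hev hord hLd hL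

open Literature.NumberTheory.EllipticCurves.Kobayashi2003 in
/-- **`a_p = 0`, `ε = −1`: `λ(L_p^ε) ≤ p − 2` ⇒ `L(E, χ, 1) ≠ 0` at every odd layer** (X6 / X7).
[cite: Pollack2003, Prop. 6.9 and Cor. 5.11] [cite: MazurTateTeitelbaum1986Invent, §I.8 (8.6)] -/
theorem forall_odd_twistedLValue_ne_zero_of_lam_signed_neg_one_le (hp2 : p ≠ 2)
    (hf : IsNewformOf W f) (hgood : W.HasGoodReductionAtPrime p) (hap : W.frobeniusTrace p = 0)
    {Lε : IwasawaAlgebra p} (hLε : IsSignedPAdicLFunction f p (-1) Lε) (hμL : mu Lε = 0)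
    (hsmall : lam Lε + 2 ≤ p) {n : ℕ} (hn : Odd n)
    (χ : DirichletCharacter ℂ (p ^ (n + cyclotomicExponent p))) (hχ : χ.IsPrimitive)
    (hev : χ.Even) (hord : ∃ j : ℕ, orderOf χ = p ^ j) {L : ℂ → ℂ} (hLd : Differentiable ℂ L)
    (hL : ∀ s : ℂ, 2 < s.re → L s = twistedLSeries f χ s) : L 1 ≠ 0 :=
  haveI : NeZero (p ^ (n + cyclotomicExponent p)) := ⟨pow_ne_zero _ hp.out.ne_zero⟩
  forall_twistedLValue_ne_zero_of_padic hf
    (fun χ' hχ' hev' hord' ↦ forall_odd_ratTwistedSymbolSum_ne_zero_of_lam_signed_neg_one_le hp2 hf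
      hgood hap hLε hμL hsmall hn χ' hχ' hev' hord') χ hχ hev hord hLd hL

open Literature.NumberTheory.EllipticCurves.Kobayashi2003 in
/-- **`a_p = 0`, `ε = +1`: `λ(L_p^ε) + p ≤ p(p−1)` ⇒ `L(E, χ, 1) ≠ 0` at every even layer `n ≥ 2`.**
[cite: Pollack2003, Prop. 6.9 and Cor. 5.11] [cite: MazurTateTeitelbaum1986Invent, §I.8 (8.6)] -/
theorem forall_even_twistedLValue_ne_zero_of_lam_signed_one_le (hp2 : p ≠ 2)
    (hf : IsNewformOf W f) (hgood : W.HasGoodReductionAtPrime p) (hap : W.frobeniusTrace p = 0)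
    {Lε : IwasawaAlgebra p} (hLε : IsSignedPAdicLFunction f p 1 Lε) (hμL : mu Lε = 0)
    (hsmall : lam Lε + p ≤ p * (p - 1)) {n : ℕ} (hn : Even n) (hn0 : 0 < n)
    (χ : DirichletCharacter ℂ (p ^ (n + cyclotomicExponent p))) (hχ : χ.IsPrimitive)
    (hev : χ.Even) (hord : ∃ j : ℕ, orderOf χ = p ^ j) {L : ℂ → ℂ} (hLd : Differentiable ℂ L)
    (hL : ∀ s : ℂ, 2 < s.re → L s = twistedLSeries f χ s) : L 1 ≠ 0 :=
  haveI : NeZero (p ^ (n + cyclotomicExponent p)) := ⟨pow_ne_zero _ hp.out.ne_zero⟩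
  forall_twistedLValue_ne_zero_of_padic hf
    (fun χ' hχ' hev' hord' ↦ forall_even_ratTwistedSymbolSum_ne_zero_of_lam_signed_one_le hp2 hf
      hgood hap hLε hμL hsmall hn hn0 χ' hχ' hev' hord') χ hχ hev hord hLd hL

end LValue

/-! ## §3. Under Kato's Cor. 14.3 (2): no Mordell–Weil growth over `(ℚ(ζ_M))^H`, relative form -/

section Kato

variable {M : ℕ} [NeZero M]

set_option backward.isDefEq.respectTransparency false in
open scoped IsMulCommutative in
/-- **Non-vanishing twists kill Mordell–Weil growth (relative form, under Kato's Cor. 14.3 (2)).**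
Assume the vendored fact `kato_finite_chiPart_of_twistedLValue_ne_zero` (`hK`; Kato, Astérisque 295,
Cor. 14.3 (2), NOT proved in the tree). Let `E = W/ℚ` be an elliptic curve with newform `f`, `M ≥ 1`,
`H ⊂ Gal(ℚ(ζ_M)/ℚ)`, and suppose that for every NON-TRIVIAL Dirichlet character `χ` mod `M` which is
trivial on `H` (as a character of the Galois group) the series `∑ χ(n) aₙ n⁻ˢ` has an entire
continuation non-vanishing at `s = 1`. Then every `P ∈ E(ℚ(ζ_M))` fixed by `H` has a positive
multiple in the image of `E(ℚ)`: `E(ℚ(ζ_M)^H)/E(ℚ)` is torsion. Proof: `N·P ∈ ∑_{χ|_H = 1} E(ℚ(ζ_M))^(χ)`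
(`exists_pos_smul_mem_iSup_chiPart_complex`); the `χ`-parts with `χ ≠ 1` are finite (Kato), the
`1`-part is the image of `E(ℚ)` (`mem_chiPart_one_iff`, Galois descent).
[cite: Kato2004Asterisque, Cor. 14.3 (2) (p. 235) and Thm. 14.4 (p. 236)] -/
theorem exists_nsmul_mem_range_baseChange_of_kato
    (hK : kato_finite_chiPart_of_twistedLValue_ne_zero) (W : WeierstrassCurve ℚ) [W.IsElliptic]
    {N : ℕ} [NeZero N] {f : CuspForm (Gamma0 N) 2} (hf : IsNewformOf W f)
    [DecidableEq (CyclotomicField M ℚ)]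
    (H : Set (CyclotomicField M ℚ ≃ₐ[ℚ] CyclotomicField M ℚ))
    (hL : ∀ χ : DirichletCharacter ℂ M, χ ≠ 1 → (∀ h ∈ H, cyclotomicCharacterOf χ h = 1) →
      ∃ L : ℂ → ℂ, Differentiable ℂ L ∧
        (∀ s : ℂ, 2 < s.re → L s = twistedLSeries f χ s) ∧ L 1 ≠ 0)
    {P : (W.baseChange (CyclotomicField M ℚ)).toAffine.Point}
    (hP : ∀ h ∈ H, Point.map (W' := W.toAffine)
      (h : CyclotomicField M ℚ →ₐ[ℚ] CyclotomicField M ℚ) P = P) :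
    ∃ n : ℕ, 0 < n ∧
      n • P ∈ Set.range (Point.baseChange (W' := W.toAffine) ℚ (CyclotomicField M ℚ)) := by
  haveI : IsMulCommutative (CyclotomicField M ℚ ≃ₐ[ℚ] CyclotomicField M ℚ) :=
    IsCyclotomicExtension.isMulCommutative {M} ℚ (CyclotomicField M ℚ)
  haveI : IsGalois ℚ (CyclotomicField M ℚ) := IsCyclotomicExtension.isGalois {M} ℚ _
  -- the Galois action on points and the isotypic exhaustion of the `H`-fixed part
  obtain ⟨N₀, hN₀, hmem⟩ := exists_pos_smul_mem_iSup_chiPart_complex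
    (G := CyclotomicField M ℚ ≃ₐ[ℚ] CyclotomicField M ℚ)
    (fun σ ↦ Point.map (W' := W.toAffine) (σ : CyclotomicField M ℚ →ₐ[ℚ] CyclotomicField M ℚ))
    (fun x ↦ by cases x <;> rfl) (fun g h x ↦ by cases x <;> rfl)
  have hNP := hmem H P hP
  -- the predicate "some positive multiple comes from `E(ℚ)`" is closed under `0`, `+`
  set C : (W.baseChange (CyclotomicField M ℚ)).toAffine.Point → Prop := fun y ↦
    ∃ n : ℕ, 0 < n ∧ n • y ∈ Set.range (Point.baseChange (W' := W.toAffine) ℚ (CyclotomicField M ℚ))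
    with hC
  have hrange_add : ∀ y z : (W.baseChange (CyclotomicField M ℚ)).toAffine.Point,
      y ∈ Set.range (Point.baseChange (W' := W.toAffine) ℚ (CyclotomicField M ℚ)) →
      z ∈ Set.range (Point.baseChange (W' := W.toAffine) ℚ (CyclotomicField M ℚ)) →
      y + z ∈ Set.range (Point.baseChange (W' := W.toAffine) ℚ (CyclotomicField M ℚ)) := by
    rintro y z ⟨a, rfl⟩ ⟨b, rfl⟩
    exact ⟨a + b, map_add _ a b⟩
  have hrange_nsmul : ∀ (k : ℕ) (y : (W.baseChange (CyclotomicField M ℚ)).toAffine.Point),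
      y ∈ Set.range (Point.baseChange (W' := W.toAffine) ℚ (CyclotomicField M ℚ)) →
      k • y ∈ Set.range (Point.baseChange (W' := W.toAffine) ℚ (CyclotomicField M ℚ)) := by
    rintro k y ⟨a, rfl⟩
    exact ⟨k • a, map_nsmul _ k a⟩
  have hC0 : C 0 := ⟨1, one_pos, ⟨0, by rw [map_zero, smul_zero]⟩⟩
  have hCadd : ∀ y z, C y → C z → C (y + z) := by
    rintro y z ⟨a, ha, hay⟩ ⟨b, hb, hbz⟩
    refine ⟨a * b, Nat.mul_pos ha hb, ?_⟩
    rw [smul_add, mul_comm a b, mul_smul, mul_comm b a, mul_smul]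
    exact hrange_add _ _ (hrange_nsmul b _ hay) (hrange_nsmul a _ hbz)
  -- each `χ`-part, `χ|_H = 1`, satisfies `C`
  have hCN : C (N₀ • P) := by
    refine AddSubgroup.iSup_induction (C := C) _ hNP (fun χ y hy ↦ ?_) hC0 hCadd
    by_cases hχH : ∀ h ∈ H, χ h = 1
    · rw [iSup_pos hχH] at hy
      obtain ⟨χD, rfl⟩ := exists_cyclotomicCharacterOf_eq χ
      by_cases h1 : χD = 1
      · -- the trivial character: Galois descent
        subst h1
        have hone : ∀ σ : CyclotomicField M ℚ ≃ₐ[ℚ] CyclotomicField M ℚ,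
            ((cyclotomicCharacterOf (1 : DirichletCharacter ℂ M) σ : ℂˣ) : ℂ) = 1 := fun σ ↦ by
          rw [coe_cyclotomicCharacterOf_apply, MulChar.one_apply_coe]
        refine ⟨1, one_pos, ?_⟩
        rw [one_smul]
        exact (mem_chiPart_one_iff W hone y).mp hy
      · -- a non-trivial character: Kato
        haveI : Finite (chiPart
            (fun σ : CyclotomicField M ℚ ≃ₐ[ℚ] CyclotomicField M ℚ ↦
              Point.map (W' := W.toAffine) (σ : CyclotomicField M ℚ →ₐ[ℚ] CyclotomicField M ℚ))
            (fun σ ↦ ((cyclotomicCharacterOf χD σ : ℂˣ) : ℂ))) :=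
          kato_finite_chiPart_cyclotomic_of_twistedLValue_ne_zero_of hK W hf χD (hL χD h1 hχH)
        obtain ⟨n, hn, hny⟩ :=
          (isOfFinAddOrder_of_finite (⟨y, hy⟩ : chiPart
            (fun σ : CyclotomicField M ℚ ≃ₐ[ℚ] CyclotomicField M ℚ ↦
              Point.map (W' := W.toAffine) (σ : CyclotomicField M ℚ →ₐ[ℚ] CyclotomicField M ℚ))
            (fun σ ↦ ((cyclotomicCharacterOf χD σ : ℂˣ) : ℂ)))).exists_nsmul_eq_zero
        refine ⟨n, hn, ⟨0, ?_⟩⟩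
        rw [map_zero]
        exact (congrArg Subtype.val hny).symm
    · rw [iSup_neg hχH, AddSubgroup.mem_bot] at hy
      rw [hy]; exact hC0
  obtain ⟨n, hn, hmemn⟩ := hCN
  exact ⟨n * N₀, Nat.mul_pos hn hN₀, by rw [mul_smul]; exact hmemn⟩

end Kato

end Summit.BirchSwinnertonDyer.Rank1Residual.Supersingular

end
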